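import Literature.AlgebraicGeometry.AbelianSchemes.AbelianSchemeQuotientPolarizationIdentity
import Literature.AlgebraicGeometry.AbelianSchemes.DualIsogenyMulN
import HarnessLib

/-!
# `ψ ≫ λ_B ≫ ψ^∨ = λ ≫ [n]_{Â}` over a reduced base (HECKE-LINK H2c export (b), all inputs discharged)

Layer `Literature/AlgebraicGeometry/AbelianSchemes`, namespace `Literature.AlgebraicGeometry.AbelianSchemes.AbelianSchemeOver`.
Cell `hodgecm-mathlib`, HECKE-LINK line card v1.2 §1: the printed polarisation identity for the quotient `B = A/K`, from ★
`comp_polarizationDesc_comp_dualIsogenyOver` (p748448: `ψ ≫ λ_B ≫ ψ^∨ = λ ≫ ([n]_A)^∨`, unconditional) and ★ `DualPair.dualIsogenyOver_mulN`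
(p747612, B-p05 (g15): `([n]_A)^∨ = [n]_{Â}` over a REDUCED locally Noetherian base under the unit normalisation `hD` of ★
`AbelianSchemeDualTransport` §4 — itself ★-discharged for polarised abelian schemes by `Polarization.nonempty_unitHatSlice_iso`, p747796).
[MumfordAV1970] §23 (p. 231), §15 Thm. 1 (p. 143).  ONE THEOREM; no definition, no instance, no sorry.  HC_CM is proved only modulo the
7 printed citations until rung 0 closes; nothing here is about HC.

## References
* [MumfordAV1970] D. Mumford, *Abelian Varieties* (1970), §15 Thm. 1 (p. 143), §23 (p. 231).
-/

noncomputable section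

universe u

open CategoryTheory CategoryTheory.Limits AlgebraicGeometry MonoidalCategory CartesianMonoidalCategory
open scoped MonObj

namespace Literature.AlgebraicGeometry.AbelianSchemes

namespace AbelianSchemeOver

open Literature.AlgebraicGeometry.RelativeSpec Literature.AlgebraicGeometry.AbelianVarieties
  Literature.AlgebraicGeometry.Motives Literature.AlgebraicGeometry.Modules

variable {S : Scheme.{u}} [IsReduced S] [IsLocallyNoetherian S] (A : AbelianSchemeOver S)
  {Y : Scheme.{u}} (u : S ⟶ Y) (K : Subgroup A.Sections) [IsCommMonObj A.X] {n : ℕ}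
  (hK : ∀ σ : K, (σ : A.Sections) ^ n = 1)
  [Finite K] [Y.IsSeparated] [IsSeparated (A.X.hom ≫ u)] [S.IsSeparated]
  (hcov : ∀ x : A.left, ∃ O : (A.translationActionOver u K).StableAffineOpens, x ∈ O.1)
  [LocallyOfFiniteType (A.X.hom ≫ u)] [IsLocallyNoetherian Y]
  (hG : ∃ _ : GrpObj (A.quotientOver u K), IsMonHom (A.quotientMk u K hcov))
  (hsm : Smooth (A.quotientOver u K).hom) (hgc : GeometricallyConnected (A.quotientOver u K).hom)
  (D : A.DualPair) [IsAffine Y]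
  (hfree : ∀ (Ω : Type u) [Field Ω] [IsAlgClosed Ω] (x : Spec (.of Ω) ⟶ A.left) (σ : K), σ ≠ 1 →
    x ≫ (A.translation (σ : A.Sections)).left ≠ x)
  (K' : Subgroup D.hat.Sections) [Finite K'] [IsSeparated (D.hat.X.hom ≫ u)]
  (hcov' : ∀ x : D.hat.left, ∃ O : (D.hat.translationActionOver u K').StableAffineOpens, x ∈ O.1)
  [LocallyOfFiniteType (D.hat.X.hom ≫ u)]
  (hG' : ∃ _ : GrpObj (D.hat.quotientOver u K'), IsMonHom (D.hat.quotientMk u K' hcov'))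
  (hsm' : Smooth (D.hat.quotientOver u K').hom) (hgc' : GeometricallyConnected (D.hat.quotientOver u K').hom)
  (hfree' : ∀ (Ω : Type u) [Field Ω] [IsAlgClosed Ω] (x : Spec (.of Ω) ⟶ D.hat.left) (σ : K'), σ ≠ 1 →
    x ≫ (D.hat.translation (σ : D.hat.Sections)).left ≠ x)
  (Φ : (prodTranslationActionOver (A.quotientBy u K hcov hG hsm hgc) D.hat u K' hcov').EquivariantStructure
    (A.poincarePullback u K hK hcov hG hsm hgc D hfree))
  (lam : A.X ⟶ D.hat.X)
  (hlam : ∀ σ : K, A.translation (σ : A.Sections) ≫ lam ≫ D.hat.quotientMk u K' hcov' = lam ≫ D.hat.quotientMk u K' hcov')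

include hfree' in
/-- **`ψ ≫ λ_B ≫ ψ^∨ = λ ≫ [n]_{Â}` over a reduced locally Noetherian base** (`B = A/K`, `λ_B := polarizationDesc`, `ψ^∨` the dual of
`ψ` for `D` and `dualPairOfQuotientRigidified … Φ h4`), under the unit normalisation `hD : (A × {ε_Â})^*𝒫 ≅ 𝒪` of `D`
(★ `comp_polarizationDesc_comp_dualIsogenyOver` + ★ `DualPair.dualIsogenyOver_mulN`). [cite: MumfordAV1970, §23 (p. 231)]
[cite: MumfordAV1970, §15 Thm. 1 (p. 143)] -/
theorem comp_polarizationDesc_comp_dualIsogenyOver_eq_comp_mulN (h4)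
    (hD : Nonempty ((Scheme.Modules.pullback (DualPair.unitHatSlice D)).obj D.P ≅ SheafOfModules.unit _)) :
    (A.quotientMk u K hcov : A.X ⟶ (A.quotientBy u K hcov hG hsm hgc).X) ≫
        A.polarizationDesc u K hcov D.hat K' hcov' lam hlam ≫
          @DualPair.dualIsogenyOver S A (A.quotientBy u K hcov hG hsm hgc) (A.quotientMk u K hcov)
            (A.isMonHom_quotientMk u K hcov hG hsm hgc) D
            (A.dualPairOfQuotientRigidified u K hK hcov hG hsm hgc D hfree K' hcov' hG' hsm' hgc' hfree' Φ h4) =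
      lam ≫ D.hat.mulN n :=
  A.comp_polarizationDesc_comp_dualIsogenyOver_of_dualIsogeny_mulN u K hK hcov hG hsm hgc D hfree K' hcov' hG' hsm' hgc'
    hfree' Φ lam hlam h4 (D.dualIsogenyOver_mulN hD n)

end AbelianSchemeOver

end Literature.AlgebraicGeometry.AbelianSchemes

end
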